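import Summits.FinalStateConjecture.FinalStateConjecture.Theorems.EIHFluxBalanceInertialRecessionRechartClockDictionary
import Summits.FinalStateConjecture.FinalStateConjecture.Theorems.EIHFluxBalanceInertialRecessionRechartStepProfile

/-!
# Route EIHFluxBalance — `InertialRecession`, re-charting: the TIME-RAISING PROFILE of a clock chart
# (the hypothesis `hraise` of `exists_carter_reach` for the rest-frame clock chart)

Helper file for the crux `stmt-FinalStateConjecture-10166`
(`Summit.FinalStateConjecture.FinalStateConjecture.Theses.EIHFluxBalance.InertialRecession`),
stub `stub_rechart` (the transfer P2 of line `sublinear-is-free-clean-window-charges`).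

Meshing `honestChart_carter_timeRaising` (…RechartCarterTimeRaising: for every `K`, eventually in
the chart time, `DT χ ≥ 1/8` on `{‖ỹ‖ ≤ K, r ≥ |a|}`) with the clause "`A =ᶠ honestChart` near late
points of bounded offset" of …StubRechart3Package by a step profile (…RechartStepProfile):
* `exists_carter_timeRaising_profile` — a monotone profile `R → ∞` (below any cap) and a time `S₁`
  with `1/8 ≤ (DA(y) χ(y))⁰` whenever `S₁ ≤ y⁰`, `‖ỹ‖ ≤ R(y⁰)`, `r(y) ≥ |a|`, `r(y) > 0`;
* `exists_carter_hraise` — the same in the model vocabulary of the rest background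
  `boostedKerrBackground 1 0 M a` (`t* = y⁰`, `r = r_a(y)`, `‖ỹ‖ ≤ r + |a|`, `r > r₊ ≥ M > |a|` on the
  domain): exactly the hypothesis `hraise` of `exists_carter_reach 1 0 …` (…RechartCarterCertify) for
  the profile `R − |a|`.
[folklore]
-/

noncomputable section

set_option linter.dupNamespace false

open Set Filter Topology Function Literature.Geometry.Lorentzian
open Summit.FinalStateConjecture.FinalStateConjecture.Theorems.SublinearIsFree.Rechart
open scoped ContDiff

namespace Summit.FinalStateConjecture.FinalStateConjecture.Theorems

/-- `‖x~‖ ≤ r_a(x) + |a|` (from `‖x~‖² − a² ≤ r²`). [folklore] -/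
theorem spatialNorm_le_radius_add_abs (a : ℝ) (x : E4) : ‖E4.spatial x‖ ≤ Kerr.radius a x + |a| := by
  have h := Kerr.spatialNorm_sq_sub_sq_le_radius_sq a x
  have hr := Kerr.radius_nonneg a x
  have h1 : ‖E4.spatial x‖ ^ 2 ≤ (Kerr.radius a x + |a|) ^ 2 := by
    have : E4.spatialNorm x = ‖E4.spatial x‖ := rfl
    rw [← this, ← sq_abs a] at *
    nlinarith [abs_nonneg a]
  exact (sq_le_sq₀ (norm_nonneg _) (by positivity)).mp h1

/-- Rest-frame bookkeeping: `poincareInv 1 0 y = y` and `(1 : O(1,3)) v = v`. [folklore] -/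
theorem poincareInv_one_zero (y : E4) : poincareInv 1 0 y = y ∧
    ∀ v : E4, ((1 : lorentzGroup) : E4 ≃L[ℝ] E4) v = v := by
  refine ⟨?_, fun v ↦ rfl⟩
  rw [poincareInv, sub_zero]; rfl

section Raise

variable (Λ : ℝ → lorentzGroup) (ξ : ℝ → E3) (T₀ : ℝ → ℝ)
  (hΛ : ContDiff ℝ ∞ (fun t ↦ ((Λ t : E4 ≃L[ℝ] E4) : E4 →L[ℝ] E4)))
  (hξ : ContDiff ℝ ∞ ξ) (hT₀ : ContDiff ℝ ∞ T₀)
  (hclock : ∀ τ, deriv T₀ τ = frameVel (Λ (T₀ τ)) 0) (hpos : ∀ t, 0 < frameVel (Λ t) 0)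
  (hdec : Tendsto (fun t ↦ deriv (fun s ↦ frameTilt (Λ s)) t) atTop (𝓝 0))
  (htop : Tendsto T₀ atTop atTop) (a : ℝ) {A : E4 → E4}
  (hhon : ∀ K : ℝ, ∃ τK : ℝ, ∀ y : E4, τK ≤ y 0 → ‖E4.spatial y‖ ≤ K →
    A =ᶠ[𝓝 y] honestChart Λ ξ T₀)
  (cap : ℝ → ℝ) (hcap : Monotone cap) (hcaptop : Tendsto cap atTop atTop)

include hΛ hξ hT₀ hclock hpos hdec htop hhon hcap hcaptop in
/-- **Time-raising profile of the clock chart.** See the module docstring. [folklore] -/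
theorem exists_carter_timeRaising_profile :
    ∃ R : ℝ → ℝ, Monotone R ∧ Tendsto R atTop atTop ∧ (∀ t, R t ≤ max (cap t) 0) ∧
      ∃ S₁ : ℝ, ∀ y : E4, S₁ ≤ y 0 → ‖E4.spatial y‖ ≤ R (y 0) → 0 < Kerr.radius a y →
        |a| ≤ Kerr.radius a y → 1 / 8 ≤ (fderiv ℝ A y (carterField a y)) 0 := by
  set Q : ℕ → ℝ → Prop := fun n t ↦ ∀ y : E4, y 0 = t → ‖E4.spatial y‖ ≤ n →
    0 < Kerr.radius a y → |a| ≤ Kerr.radius a y → 1 / 8 ≤ (fderiv ℝ A y (carterField a y)) 0 with hQ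
  have hstage : ∀ n : ℕ, ∃ T : ℝ, ∀ t, T ≤ t → Q n t := by
    intro n
    obtain ⟨τ₁, h₁⟩ := honestChart_carter_timeRaising Λ ξ T₀ hΛ hξ hT₀ hclock hpos hdec htop a
      (K := n) (Nat.cast_nonneg n)
    obtain ⟨τ₂, h₂⟩ := hhon n
    refine ⟨max τ₁ τ₂, fun t ht y hy hyK hr har ↦ ?_⟩
    have hy₁ : τ₁ ≤ y 0 := by rw [hy]; exact (le_max_left _ _).trans ht
    have hy₂ : τ₂ ≤ y 0 := by rw [hy]; exact (le_max_right _ _).trans ht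
    rw [(h₂ y hy₂ hyK).fderiv_eq]
    exact h₁ y hy₁ hyK hr har
  have hanti : ∀ m n t, m ≤ n → Q n t → Q m t := fun m n t hmn h y hy hyK ↦
    h y hy (hyK.trans (by exact_mod_cast hmn))
  obtain ⟨R, hRm, hRtop, hRcap, T, hT⟩ := exists_step_profile_le hstage hanti cap hcap hcaptop
  exact ⟨fun t ↦ (R t : ℝ), fun t t' h ↦ by show (R t : ℝ) ≤ R t'; exact_mod_cast hRm h, hRtop, hRcap, T,
    fun y hy hyR hr har ↦ hT (y 0) hy y rfl hyR hr har⟩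

include hΛ hξ hT₀ hclock hpos hdec htop hhon hcap hcaptop in
/-- **The hypothesis `hraise` of `exists_carter_reach 1 0 …` for the clock chart** (subextremal
parameters): a monotone profile `R → ∞` below the cap and a model time `S₁` after which, on
`{r ≤ R(t*) − |a|}` of the rest background, `1/8 ≤ (DA(y)χ(y))⁰`. [folklore] -/
theorem exists_carter_hraise {M : ℝ} (hsub : Kerr.IsSubextremal M a) :
    ∃ R : ℝ → ℝ, Monotone R ∧ Tendsto R atTop atTop ∧ (∀ t, R t ≤ max (cap t) 0) ∧
      ∃ S₁ : ℝ, ∀ y ∈ (boostedKerrBackground 1 0 M a).domain,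
        S₁ ≤ (boostedKerrBackground 1 0 M a).time y →
        (boostedKerrBackground 1 0 M a).radius y ≤ R ((boostedKerrBackground 1 0 M a).time y) - |a| →
        1 / 8 ≤ (fderiv ℝ A y (((1 : lorentzGroup) : E4 ≃L[ℝ] E4)
          (carterField a (poincareInv 1 0 y)))) 0 := by
  obtain ⟨R, hRm, hRtop, hRcap, S₁, hS₁⟩ := exists_carter_timeRaising_profile Λ ξ T₀ hΛ hξ hT₀ hclock
    hpos hdec htop a hhon cap hcap hcaptop
  refine ⟨R, hRm, hRtop, hRcap, S₁, fun y hy hyS hyR ↦ ?_⟩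
  obtain ⟨hp, h1⟩ := poincareInv_one_zero y
  have htime : (boostedKerrBackground 1 0 M a).time y = y 0 := by
    show poincareInv 1 0 y 0 = y 0; rw [hp]
  have hrad : (boostedKerrBackground 1 0 M a).radius y = Kerr.radius a y := by
    show Kerr.radius a (poincareInv 1 0 y) = _; rw [hp]
  rw [htime] at hyS hyR
  rw [hrad] at hyR
  rw [h1, hp]
  -- on the domain: `r > r₊ ≥ M > |a| ≥ 0`
  have hy' : poincareInv 1 0 y ∈ (Kerr.exterior M a : Set E4) := hy
  rw [hp, SetLike.mem_coe, Kerr.mem_exterior] at hy'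
  have hrp : Kerr.rPlus M a < Kerr.radius a y := (le_max_left _ _).trans_lt hy'
  have hMr : M ≤ Kerr.rPlus M a := by
    unfold Kerr.rPlus; linarith [Real.sqrt_nonneg (M ^ 2 - a ^ 2)]
  have har : |a| ≤ Kerr.radius a y := by linarith [le_of_lt hsub]
  have hr : 0 < Kerr.radius a y := (abs_nonneg a).trans_lt (lt_of_lt_of_le hsub (hMr.trans hrp.le))
  exact hS₁ y hyS ((spatialNorm_le_radius_add_abs a y).trans (by linarith)) hr har

end Raise

/-- Registered one-line form (stub `spatialNorm_le_radius_add_abs_rechart` of the crux item) of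
`spatialNorm_le_radius_add_abs`. [folklore] -/
theorem spatialNorm_le_radius_add_abs_rechart : open Literature.Geometry.Lorentzian in ∀ (a : ℝ) (x : E4), ‖E4.spatial x‖ ≤ Kerr.radius a x + |a| :=
  spatialNorm_le_radius_add_abs

end Summit.FinalStateConjecture.FinalStateConjecture.Theorems
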